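import Summits.Schanuel.Schanuel.Theorems.ZilberEacParamCurveSurface
import HarnessLib

/-!
# Polynomially parametrised base curves, XI: the NON-SPLIT surface `{(g(t), y) : Q(t; y) = 0}` is
# an irreducible closed surface (certificate)

HONEST FRAMING.  Cell `pub-schanuel` (Zilber's Exponential-Algebraic Closedness, case ladder;
host summit Schanuel), seat 2, gen 19.  Certificate file for NON-SPLIT surfaces over a polynomially
parametrised base curve (Mantova–Masser's OPEN density question, PLMS 2024 §1 p. 5); the product
case `Q = P(y₀, y₁)` is file V (`ZilberEacParamCurveSurface`), whose proofs are repeated here for a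
general `Q ∈ ℂ[t, y₀, y₁]`.  NOT Schanuel's conjecture (neither used nor implied; EAC ⇏ SC);
`EC(3,2)` stays OPEN.

THE SURFACE.  For `g₀, g₁ ∈ ℂ[t]` and `Q ∈ ℂ[t, y₀, y₁]` let
`S(g; Q) = {(g₀(t), g₁(t), y₀, y₁) : t ∈ ℂ, Q(t; y₀, y₁) = 0}` — the image of the surface `Z(Q)`
under the finite map `(t, y) ↦ (g(t), y)`.  With the substitution
`θ : x₀ ↦ g₀(t), x₁ ↦ g₁(t), yᵢ ↦ yᵢ` into `ℂ[t, y₀, y₁]` and `J = θ⁻¹((Q))`: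
* `S ⊆ Z(J)` (Part A), and `Z(J) ⊆ S` when `deg g₀ ≥ 1` (Part C) — the image of the FINITE map
  `(t, y) ↦ (g(t), y)` is closed: `ℂ[t, y]/(P̃)` is integral over `ℂ[x, y]` through `θ` (Part B,
  `t` is a root of the monic `lc(g₀)⁻¹ (g₀(T) - x₀)`), so a point of `Z(J)` lifts to a maximal ideal
  of `ℂ[t, y] ⊇ (Q)` by lying-over (`Ideal.exists_ideal_over_maximal_of_isIntegral`) and the
  Nullstellensatz names the parameter `t`;
* hence for irreducible `Q`: `S = Z(J)` is an irreducible closed set with `I(S) = J` prime, of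
  dimension `dim ℂ[t, y]/(Q) = 2` (integral extensions preserve Krull dimension,
  `Literature.RingTheory.KrullDimension.ringKrullDim_eq_of_isIntegral`) (Part D).
-/

noncomputable section

open MvPolynomial
open Literature.NumberTheory.Transcendental Literature.ModelTheory.Zilber

set_option linter.dupNamespace false

namespace Summit.Schanuel.Schanuel.Theorems

section Certificate

variable (g₀ g₁ : Polynomial ℂ)

/-! ## Part A. The substitution and `S ⊆ Z(J)` -/

/-- **`S(g; Q) ⊆ Z(θ⁻¹((Q)))`.** -/
theorem paramSurface₃_subset_zeroLocus (Q : MvPolynomial (Fin 3) ℂ) :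
    {w : Fin 2 ⊕ Fin 2 → ℂ | ∃ t : ℂ, w (Sum.inl 0) = g₀.eval t ∧ w (Sum.inl 1) = g₁.eval t ∧
      MvPolynomial.eval (Fin.cases t (fun i => w (Sum.inr i)) : Fin 3 → ℂ) Q = 0} ⊆
    zeroLocus ℂ (Ideal.comap (aeval (Sum.elim ![Polynomial.aeval (X 0 : MvPolynomial (Fin 3) ℂ) g₀,
          Polynomial.aeval (X 0 : MvPolynomial (Fin 3) ℂ) g₁]
        (fun i => X (Fin.succ i)) : Fin 2 ⊕ Fin 2 → MvPolynomial (Fin 3) ℂ) :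
        MvPolynomial (Fin 2 ⊕ Fin 2) ℂ →ₐ[ℂ] MvPolynomial (Fin 3) ℂ)
      (Ideal.span {Q})) := by
  rintro w ⟨t, hw0, hw1, hwQ⟩
  rw [mem_zeroLocus_iff]
  intro f hf
  rw [Ideal.mem_comap, Ideal.mem_span_singleton] at hf
  obtain ⟨r, hr⟩ := hf
  rw [← eval_aeval_paramSubst g₀ g₁ hw0 hw1, hr, map_mul, hwQ, zero_mul]

/-! ## Part B. `ℂ[t, y₀, y₁]/(Q)` is integral over `ℂ[x, y]` through `θ` -/

/-- **Integrality of the parameter.**  If `deg g₀ ≥ 1`, the composite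
`ℂ[x₀, x₁, y₀, y₁] →θ ℂ[t, y₀, y₁] → ℂ[t, y₀, y₁]/(Q)` is an integral ring map (`t̄` is a root of
the monic `lc(g₀)⁻¹ (g₀(T) - x₀)`; `ȳᵢ` and the constants are images). (new) -/
theorem isIntegral_paramSubst_quot₃ (hg₀ : 1 ≤ g₀.natDegree) (Q : MvPolynomial (Fin 3) ℂ) :
    (((Ideal.Quotient.mkₐ ℂ (Ideal.span {Q} : Ideal (MvPolynomial (Fin 3) ℂ))).comp
      (aeval (Sum.elim ![Polynomial.aeval (X 0 : MvPolynomial (Fin 3) ℂ) g₀,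
          Polynomial.aeval (X 0 : MvPolynomial (Fin 3) ℂ) g₁]
        (fun i => X (Fin.succ i)) : Fin 2 ⊕ Fin 2 → MvPolynomial (Fin 3) ℂ) :
        MvPolynomial (Fin 2 ⊕ Fin 2) ℂ →ₐ[ℂ] MvPolynomial (Fin 3) ℂ)).toRingHom).IsIntegral := by
  set Φ : MvPolynomial (Fin 2 ⊕ Fin 2) ℂ →ₐ[ℂ] MvPolynomial (Fin 3) ℂ ⧸
      (Ideal.span {Q} : Ideal (MvPolynomial (Fin 3) ℂ)) :=
    (Ideal.Quotient.mkₐ ℂ (Ideal.span {Q} : Ideal (MvPolynomial (Fin 3) ℂ))).comp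
      (aeval (Sum.elim ![Polynomial.aeval (X 0 : MvPolynomial (Fin 3) ℂ) g₀,
          Polynomial.aeval (X 0 : MvPolynomial (Fin 3) ℂ) g₁]
        (fun i => X (Fin.succ i)) : Fin 2 ⊕ Fin 2 → MvPolynomial (Fin 3) ℂ)) with hΦ
  set f : MvPolynomial (Fin 2 ⊕ Fin 2) ℂ →+* MvPolynomial (Fin 3) ℂ ⧸
      (Ideal.span {Q} : Ideal (MvPolynomial (Fin 3) ℂ)) := Φ.toRingHom with hf
  set mk := Ideal.Quotient.mk (Ideal.span {Q} : Ideal (MvPolynomial (Fin 3) ℂ))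
    with hmk
  have hfapply : ∀ r, f r = mk (aeval (Sum.elim ![Polynomial.aeval (X 0 : MvPolynomial (Fin 3) ℂ) g₀,
          Polynomial.aeval (X 0 : MvPolynomial (Fin 3) ℂ) g₁]
        (fun i => X (Fin.succ i)) : Fin 2 ⊕ Fin 2 → MvPolynomial (Fin 3) ℂ) r) := fun r => rfl
  -- the images of the generators
  have hC : ∀ c : ℂ, f.IsIntegralElem (mk (C c)) := by
    intro c
    have : mk (C c) = f (C c) := by rw [hfapply, MvPolynomial.algHom_C]; rfl
    rw [this]; exact f.isIntegralElem_map
  have hY : ∀ j : Fin 2, f.IsIntegralElem (mk (X (Fin.succ j))) := by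
    intro j
    have : mk (X (Fin.succ j)) = f (X (Sum.inr j)) := by rw [hfapply, MvPolynomial.aeval_X]; rfl
    rw [this]; exact f.isIntegralElem_map
  -- the parameter `t̄`
  have hT : f.IsIntegralElem (mk (X 0)) := by
    have hg0 : g₀ ≠ 0 := by
      rintro rfl
      rw [Polynomial.natDegree_zero] at hg₀; omega
    set u : ℂ := g₀.leadingCoeff with hu
    have hu0 : u ≠ 0 := Polynomial.leadingCoeff_ne_zero.2 hg0
    set gR : Polynomial (MvPolynomial (Fin 2 ⊕ Fin 2) ℂ) :=
      g₀.map (MvPolynomial.C : ℂ →+* MvPolynomial (Fin 2 ⊕ Fin 2) ℂ) with hgR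
    have hCinj : Function.Injective (MvPolynomial.C : ℂ →+* MvPolynomial (Fin 2 ⊕ Fin 2) ℂ) :=
      MvPolynomial.C_injective _ _
    have hgRdeg : gR.degree = g₀.degree := Polynomial.degree_map_eq_of_injective hCinj _
    have hgRlc : gR.leadingCoeff = MvPolynomial.C u := by
      rw [hgR, Polynomial.leadingCoeff_map_of_injective hCinj, hu]
    have hdeglt : (Polynomial.C (X (Sum.inl 0) : MvPolynomial (Fin 2 ⊕ Fin 2) ℂ)).degree < gR.degree := by
      rw [hgRdeg]
      calc (Polynomial.C (X (Sum.inl 0) : MvPolynomial (Fin 2 ⊕ Fin 2) ℂ)).degree ≤ 0 :=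
            Polynomial.degree_C_le
        _ < g₀.degree := by
            rw [Polynomial.degree_eq_natDegree hg0]; exact_mod_cast hg₀
    set q : Polynomial (MvPolynomial (Fin 2 ⊕ Fin 2) ℂ) :=
      Polynomial.C (MvPolynomial.C u⁻¹) * (gR - Polynomial.C (X (Sum.inl 0))) with hq
    have hqmonic : q.Monic := by
      apply Polynomial.monic_C_mul_of_mul_leadingCoeff_eq_one
      rw [Polynomial.leadingCoeff_sub_of_degree_lt hdeglt, hgRlc, ← map_mul, inv_mul_cancel₀ hu0,
        MvPolynomial.C_1]
    refine ⟨q, hqmonic, ?_⟩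
    -- `eval₂ f t̄ gR = f(x₀)`
    have hfC : f.comp MvPolynomial.C = algebraMap ℂ _ := by
      ext c
      simp only [RingHom.comp_apply, hfapply, MvPolynomial.algHom_C]
      rfl
    have heval : Polynomial.eval₂ f (mk (X 0)) gR = f (X (Sum.inl 0)) := by
      rw [hgR, Polynomial.eval₂_map, hfC, hfapply, MvPolynomial.aeval_X]
      simp only [Sum.elim_inl, Matrix.cons_val_zero]
      rw [hmk, ← Ideal.Quotient.mkₐ_eq_mk ℂ, ← Polynomial.aeval_algHom_apply, Polynomial.aeval_def]
    rw [hq, Polynomial.eval₂_mul, Polynomial.eval₂_C, Polynomial.eval₂_sub, Polynomial.eval₂_C, heval,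
      sub_self, mul_zero]
  -- all of the quotient
  intro b
  obtain ⟨p, rfl⟩ := Ideal.Quotient.mk_surjective b
  induction p using MvPolynomial.induction_on with
  | C c => exact hC c
  | add p q hp hq => rw [map_add]; exact hp.add f hq
  | mul_X p i hp =>
    rw [map_mul]
    exact hp.mul f (Fin.cases hT (fun j => hY j) i)

/-! ## Part C. `Z(J) ⊆ S`: the image of the finite map is closed -/

/-- **`Z(θ⁻¹((Q))) ⊆ S(g; Q)`** for `deg g₀ ≥ 1`: every point of the zero locus lies over a
parameter `t` (lying-over for the integral extension of Part B + Nullstellensatz). (new) -/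
theorem zeroLocus_subset_paramSurface₃ (hg₀ : 1 ≤ g₀.natDegree) (Q : MvPolynomial (Fin 3) ℂ) :
    zeroLocus ℂ (Ideal.comap (aeval (Sum.elim ![Polynomial.aeval (X 0 : MvPolynomial (Fin 3) ℂ) g₀,
          Polynomial.aeval (X 0 : MvPolynomial (Fin 3) ℂ) g₁]
        (fun i => X (Fin.succ i)) : Fin 2 ⊕ Fin 2 → MvPolynomial (Fin 3) ℂ) :
        MvPolynomial (Fin 2 ⊕ Fin 2) ℂ →ₐ[ℂ] MvPolynomial (Fin 3) ℂ)
      (Ideal.span {Q})) ⊆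
    {w : Fin 2 ⊕ Fin 2 → ℂ | ∃ t : ℂ, w (Sum.inl 0) = g₀.eval t ∧ w (Sum.inl 1) = g₁.eval t ∧
      MvPolynomial.eval (Fin.cases t (fun i => w (Sum.inr i)) : Fin 3 → ℂ) Q = 0} := by
  intro w hw
  set I₃ : Ideal (MvPolynomial (Fin 3) ℂ) := Ideal.span {Q} with hI₃
  set θ : Fin 2 ⊕ Fin 2 → MvPolynomial (Fin 3) ℂ :=
    Sum.elim ![Polynomial.aeval (X 0 : MvPolynomial (Fin 3) ℂ) g₀,
      Polynomial.aeval (X 0 : MvPolynomial (Fin 3) ℂ) g₁] (fun i => X (Fin.succ i)) with hθ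
  set Φ : MvPolynomial (Fin 2 ⊕ Fin 2) ℂ →ₐ[ℂ] MvPolynomial (Fin 3) ℂ ⧸ I₃ :=
    (Ideal.Quotient.mkₐ ℂ I₃).comp (aeval θ) with hΦ
  set f : MvPolynomial (Fin 2 ⊕ Fin 2) ℂ →+* MvPolynomial (Fin 3) ℂ ⧸ I₃ := Φ.toRingHom with hf
  have hfint : f.IsIntegral := isIntegral_paramSubst_quot₃ g₀ g₁ hg₀ Q
  have hfapply : ∀ r, f r = Ideal.Quotient.mk I₃ (aeval θ r) := fun r => rfl
  letI : Algebra (MvPolynomial (Fin 2 ⊕ Fin 2) ℂ) (MvPolynomial (Fin 3) ℂ ⧸ I₃) := f.toAlgebra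
  haveI : Algebra.IsIntegral (MvPolynomial (Fin 2 ⊕ Fin 2) ℂ) (MvPolynomial (Fin 3) ℂ ⧸ I₃) :=
    ⟨fun b => hfint b⟩
  haveI hmax : (vanishingIdeal ℂ ({w} : Set (Fin 2 ⊕ Fin 2 → ℂ))).IsMaximal :=
    MvPolynomial.isMaximal_iff_eq_vanishingIdeal_singleton.mpr ⟨w, rfl⟩
  have hker : RingHom.ker (algebraMap (MvPolynomial (Fin 2 ⊕ Fin 2) ℂ) (MvPolynomial (Fin 3) ℂ ⧸ I₃)) ≤
      vanishingIdeal ℂ ({w} : Set (Fin 2 ⊕ Fin 2 → ℂ)) := by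
    intro r hr
    rw [RingHom.mem_ker] at hr
    change f r = 0 at hr
    rw [hfapply, Ideal.Quotient.eq_zero_iff_mem] at hr
    rw [mem_vanishingIdeal_singleton_iff]
    rw [mem_zeroLocus_iff] at hw
    exact hw r (Ideal.mem_comap.2 hr)
  obtain ⟨M, hMmax, hMcomap⟩ := Ideal.exists_ideal_over_maximal_of_isIntegral
    (vanishingIdeal ℂ ({w} : Set (Fin 2 ⊕ Fin 2 → ℂ))) hker
  haveI : M.IsMaximal := hMmax
  haveI hM' : (M.comap (Ideal.Quotient.mk I₃)).IsMaximal :=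
    Ideal.comap_isMaximal_of_surjective _ Ideal.Quotient.mk_surjective
  obtain ⟨q, hq⟩ := MvPolynomial.isMaximal_iff_eq_vanishingIdeal_singleton.mp hM'
  -- transfer of vanishing: `r(w) = 0 ⟹ (θ r)(q) = 0`
  have key : ∀ r : MvPolynomial (Fin 2 ⊕ Fin 2) ℂ, aeval w r = 0 → aeval q (aeval θ r) = 0 := by
    intro r hr
    have h1 : r ∈ M.comap (algebraMap (MvPolynomial (Fin 2 ⊕ Fin 2) ℂ) (MvPolynomial (Fin 3) ℂ ⧸ I₃)) := by
      rw [hMcomap, mem_vanishingIdeal_singleton_iff]; exact hr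
    rw [Ideal.mem_comap] at h1
    have h2 : aeval θ r ∈ M.comap (Ideal.Quotient.mk I₃) := by
      rw [Ideal.mem_comap]; exact h1
    rw [hq, mem_vanishingIdeal_singleton_iff] at h2
    exact h2
  have hv : ∀ v : Fin 2 ⊕ Fin 2, aeval q (θ v) = w v := by
    intro v
    have h := key (X v - MvPolynomial.C (w v)) (by simp)
    rw [map_sub, MvPolynomial.aeval_X, MvPolynomial.aeval_C, map_sub, MvPolynomial.algebraMap_eq,
      MvPolynomial.aeval_C] at h
    rw [← sub_eq_zero]
    convert h using 2
    simp
  have hQq : aeval q Q = 0 := by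
    have h1 : Q ∈ M.comap (Ideal.Quotient.mk I₃) := by
      rw [Ideal.mem_comap, Ideal.Quotient.eq_zero_iff_mem.2 (Ideal.mem_span_singleton_self _)]
      exact M.zero_mem
    rw [hq, mem_vanishingIdeal_singleton_iff] at h1
    exact h1
  refine ⟨q 0, ?_, ?_, ?_⟩
  · have h := hv (Sum.inl 0)
    simp only [hθ, Sum.elim_inl, Matrix.cons_val_zero, aeval_polynomial_aeval_X] at h
    exact h.symm
  · have h := hv (Sum.inl 1)
    simp only [hθ, Sum.elim_inl, Matrix.cons_val_one, Matrix.cons_val_fin_one,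
      aeval_polynomial_aeval_X] at h
    exact h.symm
  · have hy : (Fin.cases (q 0) (fun i => w (Sum.inr i)) : Fin 3 → ℂ) = q := by
      funext i
      refine Fin.cases ?_ (fun j => ?_) i
      · rfl
      · have h := hv (Sum.inr j)
        simp only [hθ, Sum.elim_inr, MvPolynomial.aeval_X] at h
        simpa using h.symm
    rw [hy]
    exact hQq

/-! ## Part D. The certificate -/

/-- **`S(g; Q) = Z(θ⁻¹((Q)))`** (`deg g₀ ≥ 1`). (new) -/
theorem paramSurface₃_eq_zeroLocus (hg₀ : 1 ≤ g₀.natDegree) (Q : MvPolynomial (Fin 3) ℂ) :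
    {w : Fin 2 ⊕ Fin 2 → ℂ | ∃ t : ℂ, w (Sum.inl 0) = g₀.eval t ∧ w (Sum.inl 1) = g₁.eval t ∧
      MvPolynomial.eval (Fin.cases t (fun i => w (Sum.inr i)) : Fin 3 → ℂ) Q = 0} =
    zeroLocus ℂ (Ideal.comap (aeval (Sum.elim ![Polynomial.aeval (X 0 : MvPolynomial (Fin 3) ℂ) g₀,
          Polynomial.aeval (X 0 : MvPolynomial (Fin 3) ℂ) g₁]
        (fun i => X (Fin.succ i)) : Fin 2 ⊕ Fin 2 → MvPolynomial (Fin 3) ℂ) :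
        MvPolynomial (Fin 2 ⊕ Fin 2) ℂ →ₐ[ℂ] MvPolynomial (Fin 3) ℂ)
      (Ideal.span {Q})) :=
  Set.Subset.antisymm (paramSurface₃_subset_zeroLocus g₀ g₁ Q)
    (zeroLocus_subset_paramSurface₃ g₀ g₁ hg₀ Q)

variable {Q : MvPolynomial (Fin 3) ℂ}

/-- **`S(g; Q)` is an irreducible closed set** for `deg g₀ ≥ 1` and irreducible `Q`. (new) -/
theorem isIrreducibleClosed_paramSurface₃ (hg₀ : 1 ≤ g₀.natDegree) (hirr : Irreducible Q) :
    IsIrreducibleClosed ℂ {w : Fin 2 ⊕ Fin 2 → ℂ | ∃ t : ℂ, w (Sum.inl 0) = g₀.eval t ∧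
      w (Sum.inl 1) = g₁.eval t ∧
      MvPolynomial.eval (Fin.cases t (fun i => w (Sum.inr i)) : Fin 3 → ℂ) Q = 0} := by
  have hprime : Prime Q := UniqueFactorizationMonoid.irreducible_iff_prime.1 hirr
  haveI : (Ideal.span {Q} : Ideal (MvPolynomial (Fin 3) ℂ)).IsPrime :=
    (Ideal.span_singleton_prime hprime.ne_zero).2 hprime
  haveI : (Ideal.comap (aeval (Sum.elim ![Polynomial.aeval (X 0 : MvPolynomial (Fin 3) ℂ) g₀,
          Polynomial.aeval (X 0 : MvPolynomial (Fin 3) ℂ) g₁]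
        (fun i => X (Fin.succ i)) : Fin 2 ⊕ Fin 2 → MvPolynomial (Fin 3) ℂ) :
        MvPolynomial (Fin 2 ⊕ Fin 2) ℂ →ₐ[ℂ] MvPolynomial (Fin 3) ℂ)
      (Ideal.span {Q})).IsPrime := Ideal.IsPrime.comap _
  rw [paramSurface₃_eq_zeroLocus g₀ g₁ hg₀]
  exact isIrreducibleClosed_zeroLocus _

/-- **`I(S(g; Q)) = θ⁻¹((Q))`.** (new) -/
theorem vanishingIdeal_paramSurface₃ (hg₀ : 1 ≤ g₀.natDegree) (hirr : Irreducible Q) :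
    vanishingIdeal ℂ {w : Fin 2 ⊕ Fin 2 → ℂ | ∃ t : ℂ, w (Sum.inl 0) = g₀.eval t ∧
      w (Sum.inl 1) = g₁.eval t ∧
      MvPolynomial.eval (Fin.cases t (fun i => w (Sum.inr i)) : Fin 3 → ℂ) Q = 0} =
    Ideal.comap (aeval (Sum.elim ![Polynomial.aeval (X 0 : MvPolynomial (Fin 3) ℂ) g₀,
          Polynomial.aeval (X 0 : MvPolynomial (Fin 3) ℂ) g₁]
        (fun i => X (Fin.succ i)) : Fin 2 ⊕ Fin 2 → MvPolynomial (Fin 3) ℂ) :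
        MvPolynomial (Fin 2 ⊕ Fin 2) ℂ →ₐ[ℂ] MvPolynomial (Fin 3) ℂ)
      (Ideal.span {Q}) := by
  have hprime : Prime Q := UniqueFactorizationMonoid.irreducible_iff_prime.1 hirr
  haveI : (Ideal.span {Q} : Ideal (MvPolynomial (Fin 3) ℂ)).IsPrime :=
    (Ideal.span_singleton_prime hprime.ne_zero).2 hprime
  haveI : (Ideal.comap (aeval (Sum.elim ![Polynomial.aeval (X 0 : MvPolynomial (Fin 3) ℂ) g₀,
          Polynomial.aeval (X 0 : MvPolynomial (Fin 3) ℂ) g₁]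
        (fun i => X (Fin.succ i)) : Fin 2 ⊕ Fin 2 → MvPolynomial (Fin 3) ℂ) :
        MvPolynomial (Fin 2 ⊕ Fin 2) ℂ →ₐ[ℂ] MvPolynomial (Fin 3) ℂ)
      (Ideal.span {Q})).IsPrime := Ideal.IsPrime.comap _
  rw [paramSurface₃_eq_zeroLocus g₀ g₁ hg₀, MvPolynomial.IsPrime.vanishingIdeal_zeroLocus]

/-- **`dim S(g; Q) = 2`**: `ℂ[S] = ℂ[x, y]/θ⁻¹((Q))` embeds in `ℂ[t, y]/(Q)`, which is integral
over it and of dimension `2`. (new) -/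
theorem zariskiDim_paramSurface₃ (hg₀ : 1 ≤ g₀.natDegree) (hirr : Irreducible Q) :
    zariskiDim ℂ {w : Fin 2 ⊕ Fin 2 → ℂ | ∃ t : ℂ, w (Sum.inl 0) = g₀.eval t ∧
      w (Sum.inl 1) = g₁.eval t ∧
      MvPolynomial.eval (Fin.cases t (fun i => w (Sum.inr i)) : Fin 3 → ℂ) Q = 0} = (2 : ℕ) := by
  have hprime : Prime Q := UniqueFactorizationMonoid.irreducible_iff_prime.1 hirr
  set I₃ : Ideal (MvPolynomial (Fin 3) ℂ) := Ideal.span {Q} with hI₃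
  haveI : I₃.IsPrime := (Ideal.span_singleton_prime hprime.ne_zero).2 hprime
  set θ : Fin 2 ⊕ Fin 2 → MvPolynomial (Fin 3) ℂ :=
    Sum.elim ![Polynomial.aeval (X 0 : MvPolynomial (Fin 3) ℂ) g₀,
      Polynomial.aeval (X 0 : MvPolynomial (Fin 3) ℂ) g₁] (fun i => X (Fin.succ i)) with hθ
  haveI : (Ideal.comap (aeval θ : MvPolynomial (Fin 2 ⊕ Fin 2) ℂ →ₐ[ℂ] MvPolynomial (Fin 3) ℂ)
      I₃).IsPrime := Ideal.IsPrime.comap _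
  rw [paramSurface₃_eq_zeroLocus g₀ g₁ hg₀, zariskiDim_zeroLocus_eq]
  set Φ : MvPolynomial (Fin 2 ⊕ Fin 2) ℂ →ₐ[ℂ] MvPolynomial (Fin 3) ℂ ⧸ I₃ :=
    (Ideal.Quotient.mkₐ ℂ I₃).comp
      (aeval θ : MvPolynomial (Fin 2 ⊕ Fin 2) ℂ →ₐ[ℂ] MvPolynomial (Fin 3) ℂ) with hΦ
  set f : MvPolynomial (Fin 2 ⊕ Fin 2) ℂ →+* MvPolynomial (Fin 3) ℂ ⧸ I₃ := Φ.toRingHom with hf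
  have hfint : f.IsIntegral := isIntegral_paramSubst_quot₃ g₀ g₁ hg₀ Q
  have hJ : Ideal.comap (aeval θ : MvPolynomial (Fin 2 ⊕ Fin 2) ℂ →ₐ[ℂ] MvPolynomial (Fin 3) ℂ)
      I₃ = RingHom.ker f := by
    ext r
    rw [Ideal.mem_comap, RingHom.mem_ker]
    show _ ↔ Ideal.Quotient.mk I₃ (aeval θ r) = 0
    exact Ideal.Quotient.eq_zero_iff_mem.symm
  rw [ringKrullDim_eq_of_ringEquiv (Ideal.quotEquivOfEq hJ)]
  -- `R ⧸ ker f → B` is injective and integral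
  letI : Algebra (MvPolynomial (Fin 2 ⊕ Fin 2) ℂ ⧸ RingHom.ker f) (MvPolynomial (Fin 3) ℂ ⧸ I₃) :=
    (RingHom.kerLift f).toAlgebra
  haveI : Algebra.IsIntegral (MvPolynomial (Fin 2 ⊕ Fin 2) ℂ ⧸ RingHom.ker f)
      (MvPolynomial (Fin 3) ℂ ⧸ I₃) := by
    refine ⟨fun b => ?_⟩
    obtain ⟨p, hp, hpb⟩ := hfint b
    refine ⟨p.map (Ideal.Quotient.mk (RingHom.ker f)), hp.map _, ?_⟩
    rw [Polynomial.eval₂_map]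
    have hcomp : (algebraMap (MvPolynomial (Fin 2 ⊕ Fin 2) ℂ ⧸ RingHom.ker f)
        (MvPolynomial (Fin 3) ℂ ⧸ I₃)).comp (Ideal.Quotient.mk (RingHom.ker f)) = f := by
      ext r <;> simp [RingHom.algebraMap_toAlgebra]
    rw [hcomp]; exact hpb
  rw [Literature.RingTheory.KrullDimension.ringKrullDim_eq_of_isIntegral
    (R := MvPolynomial (Fin 2 ⊕ Fin 2) ℂ ⧸ RingHom.ker f) (S := MvPolynomial (Fin 3) ℂ ⧸ I₃)
    (RingHom.kerLift_injective f),
    hI₃, Literature.RingTheory.KrullDimension.ringKrullDim_quotient_span_of_prime_mvPolynomial hprime]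

end Certificate

end Summit.Schanuel.Schanuel.Theorems
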